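import Summits.CriticalPhenomena.PercolationContinuityZ3.Theorems.SahiTwoDimDensity

/-!
# `NoHeavyLowerTail` (crux stmt-CriticalPhenomena-4575), Sahi programme: Sahi's conjecture of EVERY order for EVERY
# absolutely continuous FKG probability measure on the unit square — unbounded densities

Support file (Sahi cell, typer seat, generation 5; `--supports stmt-CriticalPhenomena-4575`), sequel of
`SahiTwoDimDensity.lean`, which proved the theorem for BOUNDED log-supermodular densities.  Here the boundedness is
removed: the weighted Riemann sandwich `Σ_c μ(cell c)(g(c⁺) − g(c⁻))` tends to `0` for EVERY finite measure `μ` which is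
absolutely continuous with respect to Lebesgue measure in the `ε–δ` sense (`tendsto_gap_of_epsDelta` — the cells where a
monotone `g` jumps by more than `η` number `O((m+1)/η)`, so they cover Lebesgue area `O(1/(η(m+1)))`, hence `μ`-mass
`→ 0`; the other cells contribute `≤ η·μ([0,1]²)`), and a density `ρ ∈ L¹` has this `ε–δ` property by uniform
integrability (`exists_delta_withDensity`).

**Theorem** (`mSahiPositive_withDensity'`).  Let `ρ : [0,1]² → [0,∞]` be measurable and log-supermodular with
`∫ ρ dλ = 1`.  Then `ρ·λ` is Sahi-positive of every order (all `n`, all nonnegative monotone families); decreasing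
families: `msahiE_withDensity_nonneg_of_antitone'`.  New mathematics (the continuum form of P1's two-dimensional
theorem `SahiTwoDim.sahiPositive_of_isFKGMeasure_prod`; Lieb–Sahi's Thm. 3.7 is `ρ ≡ 1`).
-/

noncomputable section

namespace Summit.CriticalPhenomena.PercolationContinuityZ3.Theorems.SahiTwoDimDensity

open Finset Function MeasureTheory Set Filter Topology
open Literature.Combinatorics.Sahi2008 Literature.Combinatorics.Sahi2008.LebesgueSquare
open scoped unitInterval ENNReal NNReal

variable {m : ℕ}

/-! ## The gap of the weighted sandwich tends to zero under `ε–δ` absolute continuity -/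

/-- The lower-left corner of a cell is below its upper-right corner (plumbing). [this work] -/
private theorem loCorner_le_hiCorner (c : Fin (m + 1) × Fin (m + 1)) : loCorner m c ≤ hiCorner m c := by
  have h : ∀ a : ℕ, gridPt (m + 1) a ≤ gridPt (m + 1) (a + 1) := by
    intro a
    change (min ((a : ℝ) / ((m + 1 : ℕ) : ℝ)) 1 : ℝ) ≤ min (((a + 1 : ℕ) : ℝ) / ((m + 1 : ℕ) : ℝ)) 1
    refine min_le_min_right _ (div_le_div_of_nonneg_right ?_ (by positivity))
    push_cast
    linarith
  exact ⟨h c.1, h c.2⟩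

/-- The cells where a monotone `g` increases by more than `η` are few: `#{c : η < Δ_c}·η ≤ 2(m+1)(g(1,1) − g(0,0))`
(plumbing; the two-way telescoping `Σ_c Δ_c ≤ 2(m+1)(g(1,1) − g(0,0))`). [this work] -/
private theorem card_jumps_mul_le {g : I × I → ℝ} (hg : Monotone g) (η : ℝ) (m : ℕ) :
    (#{c : Fin (m + 1) × Fin (m + 1) | η < g (hiCorner m c) - g (loCorner m c)} : ℝ) * η ≤
      2 * ((m : ℝ) + 1) * (g (1, 1) - g (0, 0)) := by
  classical
  set bad := (univ.filter fun c : Fin (m + 1) × Fin (m + 1) => η < g (hiCorner m c) - g (loCorner m c)) with hbad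
  have hΔ0 : ∀ c : Fin (m + 1) × Fin (m + 1), 0 ≤ g (hiCorner m c) - g (loCorner m c) := fun c =>
    sub_nonneg.2 (hg (loCorner_le_hiCorner c))
  have htot : ∑ c, (1 : ℝ) * (g (hiCorner m c) - g (loCorner m c)) ≤ 1 * (2 * ((m : ℝ) + 1) * (g (1, 1) - g (0, 0))) :=
    sum_weight_mul_sub_le hg (fun _ => (1 : ℝ)) (fun _ => zero_le_one) fun _ => le_rfl
  simp only [one_mul] at htot
  calc (#bad : ℝ) * η = ∑ c ∈ bad, η := by rw [sum_const, nsmul_eq_mul]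
    _ ≤ ∑ c ∈ bad, (g (hiCorner m c) - g (loCorner m c)) :=
        sum_le_sum fun c hc => (by rw [hbad, mem_filter] at hc; exact hc.2.le)
    _ ≤ ∑ c, (g (hiCorner m c) - g (loCorner m c)) :=
        sum_le_sum_of_subset_of_nonneg (subset_univ _) fun c _ _ => hΔ0 c
    _ ≤ 2 * ((m : ℝ) + 1) * (g (1, 1) - g (0, 0)) := htot

/-- **The gap tends to zero.** If `μ` is a finite measure on `[0,1]²` which is `ε–δ` absolutely continuous with respect
to Lebesgue measure, then for every monotone `g` the difference of the upper and lower weighted Riemann sums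
`Σ_c μ(cell c)(g(c⁺) − g(c⁻))` tends to `0` as the mesh `1/(m+1) → 0`. [this work] -/
theorem tendsto_gap_of_epsDelta (μ : Measure (I × I)) [IsFiniteMeasure μ]
    (hδ : ∀ ε : ℝ, 0 < ε → ∃ δ : ℝ, 0 < δ ∧ ∀ s, MeasurableSet s → volume s ≤ ENNReal.ofReal δ →
      μ s ≤ ENNReal.ofReal ε)
    {g : I × I → ℝ} (hg : Monotone g) :
    Tendsto (fun m => ex (cellWeight μ m) (g ∘ hiCorner m) - ex (cellWeight μ m) (g ∘ loCorner m)) atTop (𝓝 0) := by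
  classical
  set B : ℝ := g (1, 1) - g (0, 0) with hB
  have h01 : (0 : I) ≤ 1 := Subtype.coe_le_coe.1 (by rw [Set.Icc.coe_zero, Set.Icc.coe_one]; norm_num)
  have hB0 : 0 ≤ B := sub_nonneg.2 (hg ⟨h01, h01⟩)
  have hΔ0 : ∀ m (c : Fin (m + 1) × Fin (m + 1)), 0 ≤ g (hiCorner m c) - g (loCorner m c) := fun m c =>
    sub_nonneg.2 (hg (loCorner_le_hiCorner c))
  have hΔB : ∀ m (c : Fin (m + 1) × Fin (m + 1)), g (hiCorner m c) - g (loCorner m c) ≤ B := fun m c =>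
    sub_le_sub (hg ⟨Subtype.coe_le_coe.1 (by rw [Set.Icc.coe_one]; exact (hiCorner m c).1.2.2),
      Subtype.coe_le_coe.1 (by rw [Set.Icc.coe_one]; exact (hiCorner m c).2.2.2)⟩)
      (hg ⟨Subtype.coe_le_coe.1 (by rw [Set.Icc.coe_zero]; exact (loCorner m c).1.2.1),
        Subtype.coe_le_coe.1 (by rw [Set.Icc.coe_zero]; exact (loCorner m c).2.2.1)⟩)
  -- the gap as a weighted sum of the cell increments
  have hgap : ∀ m, ex (cellWeight μ m) (g ∘ hiCorner m) - ex (cellWeight μ m) (g ∘ loCorner m) =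
      ∑ c, cellWeight μ m c * (g (hiCorner m c) - g (loCorner m c)) := by
    intro m
    rw [ex, ex, ← sum_sub_distrib]
    exact sum_congr rfl fun c _ => by simp only [Function.comp_apply]; ring
  have hgap0 : ∀ m, 0 ≤ ex (cellWeight μ m) (g ∘ hiCorner m) - ex (cellWeight μ m) (g ∘ loCorner m) := fun m => by
    rw [hgap]
    exact sum_nonneg fun c _ => mul_nonneg (cellWeight_nonneg μ c) (hΔ0 m c)
  rw [Metric.tendsto_atTop]
  intro ε hε
  set Mtot : ℝ := μ.real Set.univ with hMtot
  have hMtot0 : 0 ≤ Mtot := measureReal_nonneg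
  set η : ℝ := ε / (2 * (Mtot + 1)) with hη
  have hη0 : 0 < η := by positivity
  obtain ⟨δ, hδ0, hδμ⟩ := hδ (ε / (2 * (B + 1))) (by positivity)
  obtain ⟨M₀, hM₀⟩ := exists_nat_ge (2 * B / (η * δ))
  refine ⟨M₀, fun m hm => ?_⟩
  rw [dist_zero_right, Real.norm_eq_abs, abs_of_nonneg (hgap0 m), hgap]
  -- the cells with a large increment
  set bad := (univ.filter fun c : Fin (m + 1) × Fin (m + 1) => η < g (hiCorner m c) - g (loCorner m c)) with hbad
  have hmeas : ∀ c : Fin (m + 1) × Fin (m + 1), MeasurableSet (cellPair m ⁻¹' {c}) := fun c =>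
    (cellPair_measurable m) (measurableSet_singleton c)
  have hm1 : (0 : ℝ) < (m : ℝ) + 1 := by positivity
  -- their number, Lebesgue area and `μ`-mass
  have hcard : (#bad : ℝ) * η ≤ 2 * ((m : ℝ) + 1) * B := card_jumps_mul_le hg η m
  have hvol : volume.real (cellPair m ⁻¹' (↑bad : Set (Fin (m + 1) × Fin (m + 1)))) ≤ δ := by
    rw [← sum_measureReal_preimage_singleton bad (fun c _ => hmeas c)]
    simp only [volume_real_cell, LiebSahiGrid.gridWeight, sum_const, nsmul_eq_mul]
    push_cast
    -- `#bad / (m+1)² ≤ 2B/(η (m+1)) ≤ δ`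
    have h1 : (#bad : ℝ) ≤ 2 * ((m : ℝ) + 1) * B / η := by
      rw [le_div_iff₀ hη0]; exact hcard
    have h2 : 2 * B / (η * δ) ≤ (m : ℝ) + 1 := by
      have : (M₀ : ℝ) ≤ m := by exact_mod_cast hm
      linarith
    have h3 : 2 * B ≤ η * δ * ((m : ℝ) + 1) := by
      rw [div_le_iff₀ (by positivity)] at h2; linarith
    calc (#bad : ℝ) * (1 / ((m : ℝ) + 1) ^ 2) ≤ 2 * ((m : ℝ) + 1) * B / η * (1 / ((m : ℝ) + 1) ^ 2) :=
          mul_le_mul_of_nonneg_right h1 (by positivity)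
      _ = 2 * B / (η * ((m : ℝ) + 1)) := by field_simp
      _ ≤ δ := by
          rw [div_le_iff₀ (by positivity)]
          nlinarith
  have hμbad : μ.real (cellPair m ⁻¹' (↑bad : Set (Fin (m + 1) × Fin (m + 1)))) ≤ ε / (2 * (B + 1)) := by
    have hs : MeasurableSet (cellPair m ⁻¹' (↑bad : Set (Fin (m + 1) × Fin (m + 1)))) :=
      (cellPair_measurable m) bad.measurableSet
    have h := hδμ _ hs ((ENNReal.le_ofReal_iff_toReal_le (measure_ne_top _ _) hδ0.le).2 hvol)
    exact ENNReal.toReal_le_of_le_ofReal (by positivity) h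
  -- split the gap
  have hsplit : ∑ c, cellWeight μ m c * (g (hiCorner m c) - g (loCorner m c)) =
      (∑ c ∈ bad, cellWeight μ m c * (g (hiCorner m c) - g (loCorner m c))) +
        ∑ c ∈ univ \ bad, cellWeight μ m c * (g (hiCorner m c) - g (loCorner m c)) := by
    rw [← sum_union disjoint_sdiff, union_sdiff_of_subset (subset_univ _)]
  have hbad_le : ∑ c ∈ bad, cellWeight μ m c * (g (hiCorner m c) - g (loCorner m c)) ≤
      B * (ε / (2 * (B + 1))) := by
    calc ∑ c ∈ bad, cellWeight μ m c * (g (hiCorner m c) - g (loCorner m c))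
        ≤ ∑ c ∈ bad, cellWeight μ m c * B :=
          sum_le_sum fun c _ => mul_le_mul_of_nonneg_left (hΔB m c) (cellWeight_nonneg μ c)
      _ = B * μ.real (cellPair m ⁻¹' (↑bad : Set (Fin (m + 1) × Fin (m + 1)))) := by
          rw [← sum_mul, mul_comm, ← sum_measureReal_preimage_singleton bad (fun c _ => hmeas c)]
          rfl
      _ ≤ B * (ε / (2 * (B + 1))) := mul_le_mul_of_nonneg_left hμbad hB0
  have hgood_le : ∑ c ∈ univ \ bad, cellWeight μ m c * (g (hiCorner m c) - g (loCorner m c)) ≤ η * Mtot := by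
    calc ∑ c ∈ univ \ bad, cellWeight μ m c * (g (hiCorner m c) - g (loCorner m c))
        ≤ ∑ c ∈ univ \ bad, cellWeight μ m c * η := by
          refine sum_le_sum fun c hc => mul_le_mul_of_nonneg_left ?_ (cellWeight_nonneg μ c)
          rw [Finset.mem_sdiff, hbad, Finset.mem_filter] at hc
          exact not_lt.1 fun h => hc.2 ⟨mem_univ _, h⟩
      _ ≤ ∑ c, cellWeight μ m c * η :=
          sum_le_sum_of_subset_of_nonneg (subset_univ _) fun c _ _ =>
            mul_nonneg (cellWeight_nonneg μ c) hη0.le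
      _ = η * Mtot := by
          rw [← sum_mul, mul_comm, hMtot]
          unfold cellWeight
          rw [sum_measureReal_preimage_singleton univ (fun c _ => hmeas c), coe_univ, Set.preimage_univ]
  rw [hsplit]
  have h1 : B * (ε / (2 * (B + 1))) ≤ ε / 2 := by
    have hB1 : B + 1 ≠ 0 := by positivity
    have e : B * (ε / (2 * (B + 1))) = ε / 2 * (B / (B + 1)) := by
      field_simp
    rw [e]
    exact mul_le_of_le_one_right (by positivity) (div_le_one_of_le₀ (by linarith) (by positivity))
  have h2 : η * Mtot < ε / 2 := by
    have hM1 : Mtot + 1 ≠ 0 := by positivity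
    have e : η * Mtot = ε / 2 * (Mtot / (Mtot + 1)) := by
      rw [hη]
      field_simp
    rw [e]
    exact mul_lt_of_lt_one_right (by positivity) ((div_lt_one (by positivity)).2 (lt_add_one _))
  linarith [hbad_le, hgood_le]

/-! ## From `ε–δ` absolute continuity and FKG cell weights to Sahi positivity -/

/-- `ε–δ` absolute continuity implies absolute continuity. [this work] -/
theorem absolutelyContinuous_of_epsDelta (μ : Measure (I × I))
    (hδ : ∀ ε : ℝ, 0 < ε → ∃ δ : ℝ, 0 < δ ∧ ∀ s, MeasurableSet s → volume s ≤ ENNReal.ofReal δ →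
      μ s ≤ ENNReal.ofReal ε) : μ ≪ volume := by
  refine Measure.AbsolutelyContinuous.mk fun s hs hs0 => ?_
  refine le_antisymm (ENNReal.le_of_forall_pos_le_add fun ε hε _ => ?_) bot_le
  obtain ⟨δ, hδ0, h⟩ := hδ ε hε
  have h' := h s hs (by rw [hs0]; exact bot_le)
  rw [zero_add]
  exact h'.trans ENNReal.ofReal_coe_nnreal.le

/-- **The joint moments of the grid family converge** (any probability measure on the square that is `ε–δ`
absolutely continuous with respect to Lebesgue measure). [this work] -/
theorem tendsto_gridMoment_of_epsDelta (μ : Measure (I × I)) [IsProbabilityMeasure μ]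
    (hδ : ∀ ε : ℝ, 0 < ε → ∃ δ : ℝ, 0 < δ ∧ ∀ s, MeasurableSet s → volume s ≤ ENNReal.ofReal δ →
      μ s ≤ ENNReal.ofReal ε)
    {n : ℕ} {f : Fin n → I × I → ℝ} (hf0 : ∀ i x, 0 ≤ f i x) (hmono : ∀ i, Monotone (f i)) (S : Finset (Fin n)) :
    Tendsto (fun m => ex (cellWeight μ m) (∏ i ∈ S, gridFam m f i)) atTop (𝓝 (∫ p, (∏ i ∈ S, f i) p ∂μ)) := by
  classical
  set g : I × I → ℝ := ∏ i ∈ S, f i with hgdef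
  have hg : Monotone g := by
    rw [hgdef]
    clear hgdef g
    induction S using Finset.induction_on with
    | empty =>
      rw [Finset.prod_empty]
      exact monotone_const
    | insert a S ha ih =>
      rw [Finset.prod_insert ha]
      exact (hmono a).mul ih (hf0 a) fun x => by
        rw [Finset.prod_apply]; exact prod_nonneg fun i _ => hf0 i x
  have hgi : Integrable g μ :=
    integrable_of_monotone_of_absolutelyContinuous μ (absolutelyContinuous_of_epsDelta μ hδ) hg
  have hlo : ∀ m, ex (cellWeight μ m) (∏ i ∈ S, gridFam m f i) = ex (cellWeight μ m) (g ∘ loCorner m) := by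
    intro m
    congr 1
    funext c
    simp only [Finset.prod_apply, Function.comp_apply, gridFam, hgdef]
  simp only [hlo]
  have hgap := tendsto_gap_of_epsDelta μ hδ hg
  have hlim0 : Tendsto (fun m => (∫ p, g p ∂μ) -
      (ex (cellWeight μ m) (g ∘ hiCorner m) - ex (cellWeight μ m) (g ∘ loCorner m))) atTop (𝓝 (∫ p, g p ∂μ)) := by
    simpa using (tendsto_const_nhds (x := ∫ p, g p ∂μ)).sub hgap
  refine tendsto_of_tendsto_of_tendsto_of_le_of_le hlim0 tendsto_const_nhds (fun m => ?_) fun m => ?_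
  · have h1 := integral_le_ex_hiCorner (m := m) μ hg hgi
    linarith
  · exact ex_loCorner_le_integral μ hg hgi

/-- **Criterion, unbounded form.** A probability measure on `[0,1]²` which is `ε–δ` absolutely continuous with
respect to Lebesgue measure and whose cell weights are an FKG weight on every grid `Fin (m+1) × Fin (m+1)` is
Sahi-positive of every order (P1's discrete theorem on each grid + continuity of the moment polynomial). [this work] -/
theorem mSahiPositive_of_cellWeights_of_epsDelta (μ : Measure (I × I)) [IsProbabilityMeasure μ]
    (hδ : ∀ ε : ℝ, 0 < ε → ∃ δ : ℝ, 0 < δ ∧ ∀ s, MeasurableSet s → volume s ≤ ENNReal.ofReal δ →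
      μ s ≤ ENNReal.ofReal ε)
    (hFKG : ∀ m, IsFKGMeasure (cellWeight μ m)) (n : ℕ) : MSahiPositive μ n := by
  intro f hf0 hmono
  set M : Finset (Fin n) → ℝ := fun S => ∫ p, (∏ i ∈ S, f i) p ∂μ with hM
  have hE : msahiE μ n f = momentE n M := msahiE_eq_momentE _ n f
  have hlim : Tendsto (fun m => momentE n fun S => ex (cellWeight μ m) (∏ i ∈ S, gridFam m f i))
      atTop (𝓝 (momentE n M)) :=
    ((continuous_momentE n).tendsto M).comp
      (tendsto_pi_nhds.2 fun S => tendsto_gridMoment_of_epsDelta μ hδ hf0 hmono S)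
  have hpos : ∀ m, 0 ≤ momentE n fun S => ex (cellWeight μ m) (∏ i ∈ S, gridFam m f i) := by
    intro m
    rw [← sahiE_eq_momentE]
    exact SahiTwoDim.sahiPositive_of_isFKGMeasure_prod (hFKG m) n _ (gridFam_nonneg hf0 m)
      (gridFam_monotone hmono m)
  rw [hE]
  exact ge_of_tendsto' hlim hpos

/-! ## Densities in `L¹` are `ε–δ` absolutely continuous -/

/-- **A finite density is `ε–δ` absolutely continuous** (uniform integrability of one `L¹` function):
`∫ ρ dλ < ∞` ⇒ for every `ε > 0` there is `δ > 0` with `(ρ·λ)(s) ≤ ε` whenever `λ(s) ≤ δ`. [this work] -/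
theorem exists_delta_withDensity (ρ : I × I → ℝ≥0∞) (hρm : Measurable ρ)
    (hfin : ∫⁻ p, ρ p ∂volume ≠ ∞) {ε : ℝ} (hε : 0 < ε) :
    ∃ δ : ℝ, 0 < δ ∧ ∀ s, MeasurableSet s → volume s ≤ ENNReal.ofReal δ →
      volume.withDensity ρ s ≤ ENNReal.ofReal ε := by
  have hint : Integrable (fun p => (ρ p).toReal) (volume : Measure (I × I)) :=
    integrable_toReal_of_lintegral_ne_top hρm.aemeasurable hfin
  have hLp : MemLp (fun p => (ρ p).toReal) 1 (volume : Measure (I × I)) := memLp_one_iff_integrable.2 hint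
  obtain ⟨δ, hδ0, h⟩ := hLp.eLpNorm_indicator_le le_rfl ENNReal.one_ne_top hε
  refine ⟨δ, hδ0, fun s hs hvol => ?_⟩
  have key := h s hs hvol
  rw [eLpNorm_one_eq_lintegral_enorm] at key
  have hae : ∀ᵐ p ∂(volume : Measure (I × I)), ρ p < ∞ := ae_lt_top hρm hfin
  rw [withDensity_apply ρ hs, ← lintegral_indicator hs]
  refine le_trans (le_of_eq (lintegral_congr_ae ?_)) key
  filter_upwards [hae] with p hp
  by_cases hps : p ∈ s
  · rw [Set.indicator_of_mem hps, Set.indicator_of_mem hps, Real.enorm_eq_ofReal ENNReal.toReal_nonneg,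
      ENNReal.ofReal_toReal hp.ne]
  · rw [Set.indicator_of_notMem hps, Set.indicator_of_notMem hps, enorm_zero]

/-- **Every absolutely continuous FKG probability measure on the unit square is Sahi-positive of every order —
unbounded densities.**  For a measurable log-supermodular `ρ : [0,1]² → [0,∞]` with `∫ ρ dλ = 1`, the measure `ρ·λ`
satisfies `E_n(f_0,…,f_{n−1}) ≥ 0` for every `n` and all nonnegative monotone increasing `f_i`.  New mathematics
(the continuum form of P1's theorem; `SahiTwoDimDensity.mSahiPositive_withDensity` had `ρ` bounded). [this work] -/
theorem mSahiPositive_withDensity' (ρ : I × I → ℝ≥0∞) (hρm : Measurable ρ)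
    (hρ : ∀ p q, ρ p * ρ q ≤ ρ (p ⊔ q) * ρ (p ⊓ q)) [hP : IsProbabilityMeasure (volume.withDensity ρ)] (n : ℕ) :
    MSahiPositive (volume.withDensity ρ) n := by
  have hfin : ∫⁻ p, ρ p ∂volume ≠ ∞ := by
    rw [← setLIntegral_univ, ← withDensity_apply ρ MeasurableSet.univ]
    exact measure_ne_top _ _
  exact mSahiPositive_of_cellWeights_of_epsDelta _ (fun ε hε => exists_delta_withDensity ρ hρm hfin hε)
    (isFKGMeasure_cellWeight_withDensity ρ hρm hρ) n


/-- The reflection turns `⊔` into `⊓` (plumbing). [this work] -/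
private theorem reflMap_sup (p q : I × I) :
    Prod.map unitInterval.symm unitInterval.symm (p ⊔ q) =
      Prod.map unitInterval.symm unitInterval.symm p ⊓ Prod.map unitInterval.symm unitInterval.symm q :=
  have h : Antitone unitInterval.symm := fun _ _ hab => unitInterval.symm_le_symm.2 hab
  Prod.ext (h.map_sup p.1 q.1) (h.map_sup p.2 q.2)

/-- The reflection turns `⊓` into `⊔` (plumbing). [this work] -/
private theorem reflMap_inf (p q : I × I) :
    Prod.map unitInterval.symm unitInterval.symm (p ⊓ q) =
      Prod.map unitInterval.symm unitInterval.symm p ⊔ Prod.map unitInterval.symm unitInterval.symm q :=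
  have h : Antitone unitInterval.symm := fun _ _ hab => unitInterval.symm_le_symm.2 hab
  Prod.ext (h.map_inf p.1 q.1) (h.map_inf p.2 q.2)

/-- The reflection is a measurable embedding (plumbing). [this work] -/
private theorem measurableEmbedding_reflMap :
    MeasurableEmbedding (Prod.map unitInterval.symm unitInterval.symm : I × I → I × I) :=
  (unitInterval.symmMeasurableEquiv.prodCongr unitInterval.symmMeasurableEquiv).measurableEmbedding

/-- The reflection preserves Lebesgue measure (plumbing). [this work] -/
private theorem measurePreserving_reflMap :
    MeasurePreserving (Prod.map unitInterval.symm unitInterval.symm : I × I → I × I) (volume : Measure (I × I))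
      volume := by
  rw [Measure.volume_eq_prod]
  exact unitInterval.measurePreserving_symm.prod unitInterval.measurePreserving_symm

/-- The reflection pushes `(ρ ∘ refl)·λ` to `ρ·λ` (plumbing). [this work] -/
private theorem measurePreserving_reflMap_withDensity (ρ : I × I → ℝ≥0∞) (hρm : Measurable ρ) :
    MeasurePreserving (Prod.map unitInterval.symm unitInterval.symm : I × I → I × I)
      (volume.withDensity (ρ ∘ Prod.map unitInterval.symm unitInterval.symm)) (volume.withDensity ρ) := by
  refine ⟨measurableEmbedding_reflMap.measurable, ?_⟩
  ext s hs
  rw [Measure.map_apply measurableEmbedding_reflMap.measurable hs,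
    withDensity_apply _ (measurableEmbedding_reflMap.measurable hs), withDensity_apply _ hs]
  exact measurePreserving_reflMap.setLIntegral_comp_preimage hs hρm

/-- The decreasing form, unbounded densities: nonnegative monotone DECREASING families also have `E_n ≥ 0` under
`ρ·λ` for every measurable log-supermodular probability density `ρ` on `[0,1]²`. [this work] -/
theorem msahiE_withDensity_nonneg_of_antitone' (ρ : I × I → ℝ≥0∞) (hρm : Measurable ρ)
    (hρ : ∀ p q, ρ p * ρ q ≤ ρ (p ⊔ q) * ρ (p ⊓ q)) [IsProbabilityMeasure (volume.withDensity ρ)] (n : ℕ)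
    (f : Fin n → I × I → ℝ) (hf0 : ∀ i x, 0 ≤ f i x) (hanti : ∀ i, Antitone (f i)) :
    0 ≤ msahiE (volume.withDensity ρ) n f := by
  have hpush := measurePreserving_reflMap_withDensity ρ hρm
  haveI : IsProbabilityMeasure (volume.withDensity (ρ ∘ Prod.map unitInterval.symm unitInterval.symm)) := by
    constructor
    have h := hpush.measure_preimage (s := Set.univ) MeasurableSet.univ.nullMeasurableSet
    rw [Set.preimage_univ] at h
    rw [h]
    exact measure_univ
  rw [← msahiE_comp_measurePreserving hpush measurableEmbedding_reflMap n f]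
  refine mSahiPositive_withDensity' (ρ ∘ Prod.map unitInterval.symm unitInterval.symm)
    (hρm.comp measurableEmbedding_reflMap.measurable) (fun p q => ?_) n _ (fun i x => hf0 i _)
    fun i p q hpq => hanti i ?_
  · simp only [Function.comp_apply, reflMap_sup, reflMap_inf]
    rw [mul_comm (ρ (Prod.map unitInterval.symm unitInterval.symm p ⊓
      Prod.map unitInterval.symm unitInterval.symm q))]
    exact hρ _ _
  · exact ⟨unitInterval.symm_le_symm.2 hpq.1, unitInterval.symm_le_symm.2 hpq.2⟩

end Summit.CriticalPhenomena.PercolationContinuityZ3.Theorems.SahiTwoDimDensity
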